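import Literature.MathematicalPhysics.QuantumLattice.XYOrderIntegralProofs
import HarnessLib

/-!
# Kennedy–Lieb–Shastry, XY model: the lattice integral decreases with the dimension (fact (M))

Trunk T-QLATTICE; sibling proof file of `XYOrderProofs.lean` (the named facts) and
`XYOrderIntegralProofs.lean` (the analytic inputs (E), (R'')). No statement is introduced or
changed; this file discharges

* `klsIntegral_le_two_holds : klsIntegral_le_two` — fact **(M)**: `I(ν) ≤ I(2)` for every
  `ν ≥ 2`, where `I(ν) = (2π)^{-ν} ∫_{[-π,π]^ν} F_ν`,
  `F_ν(p) = [Σᵢ(1 + cos pᵢ)/Σᵢ(1 - cos pᵢ)]^{1/2} {ν⁻¹ Σᵢ cos pᵢ}₊` (Kennedy–Lieb–Shastry 1988,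
  eq. (8)).

The source (PRL 61 (1988) 2583–2584, the paragraph after eq. (8)): "We shall now prove that
`I(ν) ≤ I(2)` for `ν ≥ 3` … Let `F(x) = x[(1+x)/(1-x)]^{1/2}` for `0 ≤ x ≤ 1`. One checks that `F`
is monotone increasing and convex. … `Y(p) = ν⁻¹ Σᵢ cos pᵢ`. The integrand in (8) is `F({Y(p)}₊)`.
Now `Y(p) = (ν² - ν)⁻¹ Σ_{i≠j} Y_{ij}(p)` … Since `F` is convex,
`F({Y(p)}₊) ≤ (ν² - ν)⁻¹ Σ_{i≠j} F({Y_{ij}(p)}₊)`. But `(2π)^{-ν} ∫ F({Y_{ij}(p)}₊) dᵛp = I(2)`. This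
proves `I(ν) ≤ I(2)`. By the same analysis one can also prove that `I(ν) ≤ I(μ)` whenever
`ν > μ`."

We formalise "the same analysis" in its one-step form `μ = ν - 1` and iterate: with
`G(y) = √((1+y)/(1-y)) y₊ = F(y₊)`, convex on `[-1, 1)` (`convexOn_klsG` of
`XYOrderIntegralProofs.lean`), and `Y(p)` the average of the `d + 1` leave-one-out averages
`Y_k(p) = d⁻¹ Σ_{i ≠ k} cos pᵢ`, Jensen gives `F_{d+1}(p) ≤ (d+1)⁻¹ Σ_k F_d(p with pₖ deleted)`
for a.e. `p` (`klsIntegrand_succ_le_avg`; "a.e." because `cos pᵢ = 1` only on a null set), and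
deleting a coordinate carries `dp` on `[-π,π]^{d+1}` to `dp_k ⊗ dq` (Mathlib
`measurePreserving_piFinSuccAbove`), so `∫_{[-π,π]^{d+1}} F_{d+1} ≤ 2π ∫_{[-π,π]^d} F_d`
(`lintegral_klsIntegrand_succ_le`, Lebesgue integrals in `ℝ≥0∞`), i.e. `I(d+1) ≤ I(d)`
(`klsIntegral_succ_le`); finiteness of all these integrals follows inductively from
`∫_{[-π,π]²} F₂ ≤ 6√2π` (`lintegral_klsIntegrand_two_le`). Hence `I` is nonincreasing on
`{2, 3, …}` (`klsIntegral_antitone`, the source's closing remark) and in particular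
`I(ν) ≤ I(2)`.

## References
* [KLS1988PRL] T. Kennedy, E. H. Lieb, B. S. Shastry, *The XY model has long-range order for all
  spins and all dimensions greater than one*, Phys. Rev. Lett. 61 (1988) 2582–2584, eq. (8) and
  the paragraph following it (pp. 2583–2584); reprinted in E. H. Lieb, *Statistical Mechanics
  (Selecta)*, Springer 2004, paper IV.8.
-/

noncomputable section

open MeasureTheory Set Filter Topology
open scoped ENNReal
open Literature.MathematicalPhysics.QuantumLattice Literature.Probability.LatticeModels

namespace Literature.MathematicalPhysics.QuantumLattice

section DimensionMonotone

/-! ### Discrete Jensen over the leave-one-out averages -/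

/-- `Σ_k Σ_{i ≠ k} fᵢ = d Σᵢ fᵢ` on `Fin (d+1)` (each index is omitted exactly once). [folklore] -/
theorem sum_sum_succAbove_eq {d : ℕ} (f : Fin (d + 1) → ℝ) :
    ∑ k : Fin (d + 1), ∑ j : Fin d, f (k.succAbove j) = d * ∑ i, f i := by
  have h : ∀ k : Fin (d + 1), ∑ j : Fin d, f (k.succAbove j) = (∑ i, f i) - f k := fun k => by
    rw [Fin.sum_univ_succAbove f k]
    ring
  simp_rw [h]
  rw [Finset.sum_sub_distrib, Finset.sum_const, Finset.card_univ, Fintype.card_fin, nsmul_eq_mul]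
  push_cast
  ring

/-- **Discrete Jensen, leave-one-out form** (Kennedy–Lieb–Shastry's convexity argument with
`μ = ν - 1`): if all `cos pᵢ < 1`, then
`F_{d+1}(p) ≤ (d+1)⁻¹ Σ_k F_d(p₀, …, p̂ₖ, …, p_d)`, because `(d+1)⁻¹ Σᵢ cos pᵢ` is the average of
the `d + 1` leave-one-out averages `d⁻¹ Σ_{i ≠ k} cos pᵢ ∈ [-1, 1)` and
`G(y) = √((1+y)/(1-y)) y₊` is convex on `[-1, 1)`.
[Kennedy–Lieb–Shastry 1988, after eq. (8)] [cite: KLS1988PRL, after eq. (8)] -/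
theorem klsIntegrand_succ_le_avg {d : ℕ} (hd : 1 ≤ d) (p : Fin (d + 1) → ℝ)
    (hp : ∀ i, Real.cos (p i) < 1) :
    klsIntegrand (d + 1) p ≤
      (∑ k : Fin (d + 1), klsIntegrand d (fun j => p (k.succAbove j))) / ((d + 1 : ℕ) : ℝ) := by
  have hd0 : d ≠ 0 := by omega
  have hdpos : (0 : ℝ) < d := by exact_mod_cast hd
  have hd1 : (0 : ℝ) < ((d + 1 : ℕ) : ℝ) := by positivity
  -- the leave-one-out averages lie in `[-1, 1)`
  have hymem : ∀ k ∈ (Finset.univ : Finset (Fin (d + 1))),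
      (fun k : Fin (d + 1) => (∑ j : Fin d, Real.cos (p (k.succAbove j))) / d) k ∈
        Set.Ico (-1 : ℝ) 1 := by
    intro k _
    constructor
    · rw [le_div_iff₀ hdpos]
      have h : ∑ _j : Fin d, (-1 : ℝ) ≤ ∑ j : Fin d, Real.cos (p (k.succAbove j)) :=
        Finset.sum_le_sum fun j _ => Real.neg_one_le_cos _
      rw [Finset.sum_const, Finset.card_univ, Fintype.card_fin] at h
      simpa using h
    · rw [div_lt_one hdpos]
      have h : ∑ j : Fin d, Real.cos (p (k.succAbove j)) < ∑ _j : Fin d, (1 : ℝ) :=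
        Finset.sum_lt_sum_of_nonempty ⟨⟨0, by omega⟩, Finset.mem_univ _⟩ fun j _ => hp _
      rw [Finset.sum_const, Finset.card_univ, Fintype.card_fin] at h
      simpa using h
  have hw : ∑ _k : Fin (d + 1), (1 / ((d + 1 : ℕ) : ℝ)) = 1 := by
    rw [Finset.sum_const, Finset.card_univ, Fintype.card_fin, nsmul_eq_mul]
    field_simp
  have hJ := convexOn_klsG.map_sum_le (t := Finset.univ) (w := fun _ => 1 / ((d + 1 : ℕ) : ℝ))
    (p := fun k : Fin (d + 1) => (∑ j : Fin d, Real.cos (p (k.succAbove j))) / d)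
    (fun _ _ => by positivity) hw hymem
  -- the barycentre is the full average
  have hbary : ∑ k : Fin (d + 1), (1 / ((d + 1 : ℕ) : ℝ)) •
      ((∑ j : Fin d, Real.cos (p (k.succAbove j))) / d) =
        (∑ i, Real.cos (p i)) / ((d + 1 : ℕ) : ℝ) := by
    simp only [smul_eq_mul]
    rw [← Finset.mul_sum, ← Finset.sum_div, sum_sum_succAbove_eq (fun i => Real.cos (p i))]
    field_simp
  rw [hbary] at hJ
  rw [klsIntegrand_eq_G (Nat.succ_ne_zero d)]
  refine hJ.trans (le_of_eq ?_)
  rw [Finset.sum_div]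
  refine Finset.sum_congr rfl fun k _ => ?_
  rw [klsIntegrand_eq_G hd0, smul_eq_mul]
  ring

/-! ### Deleting a coordinate: `∫_{[-π,π]^{d+1}} f(p̂ₖ) dp = 2π ∫_{[-π,π]^d} f` -/

/-- **Integrating out the deleted coordinate** (Tonelli on `[-π,π]^{d+1} ≅ [-π,π] × [-π,π]^d`
at the coordinate `k`, Mathlib `measurePreserving_piFinSuccAbove`): for measurable `f ≥ 0` on
`ℝ^d`, `∫_{[-π,π]^{d+1}} f(p with pₖ deleted) dp = 2π ∫_{[-π,π]^d} f(q) dq`. [folklore] -/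
theorem setLIntegral_box_comp_succAbove {d : ℕ} (k : Fin (d + 1)) {f : (Fin d → ℝ) → ℝ≥0∞}
    (hf : Measurable f) :
    ∫⁻ p in Set.pi univ (fun _ : Fin (d + 1) => Icc (-Real.pi) Real.pi),
        f (fun j => p (k.succAbove j)) =
      ENNReal.ofReal (2 * Real.pi) *
        ∫⁻ q in Set.pi univ (fun _ : Fin d => Icc (-Real.pi) Real.pi), f q := by
  set μ₀ : Measure ℝ := volume.restrict (Icc (-Real.pi) Real.pi) with hμ₀
  have hbox : ∀ n : ℕ, (volume : Measure (Fin n → ℝ)).restrict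
      (Set.pi univ fun _ : Fin n => Icc (-Real.pi) Real.pi) = Measure.pi fun _ : Fin n => μ₀ :=
    fun n => by rw [volume_pi, Measure.restrict_pi_pi]
  have hμ₀u : μ₀ univ = ENNReal.ofReal (2 * Real.pi) := by
    rw [hμ₀, Measure.restrict_apply_univ, Real.volume_Icc]
    congr 1
    ring
  rw [hbox (d + 1), hbox d]
  have he := measurePreserving_piFinSuccAbove (n := d) (α := fun _ => ℝ) (fun _ => μ₀) k
  calc ∫⁻ p, f (fun j => p (k.succAbove j)) ∂(Measure.pi fun _ : Fin (d + 1) => μ₀)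
      = ∫⁻ p, (f ∘ Prod.snd) (MeasurableEquiv.piFinSuccAbove (fun _ : Fin (d + 1) => ℝ) k p)
          ∂(Measure.pi fun _ : Fin (d + 1) => μ₀) := rfl
    _ = ∫⁻ z, (f ∘ Prod.snd) z ∂(μ₀.prod (Measure.pi fun _ : Fin d => μ₀)) :=
        he.lintegral_comp_emb (MeasurableEquiv.measurableEmbedding _) _
    _ = ∫⁻ _a, ∫⁻ q, f q ∂(Measure.pi fun _ : Fin d => μ₀) ∂μ₀ :=
        lintegral_prod _ (hf.comp measurable_snd).aemeasurable
    _ = ENNReal.ofReal (2 * Real.pi) * ∫⁻ q, f q ∂(Measure.pi fun _ : Fin d => μ₀) := by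
        rw [lintegral_const, hμ₀u, mul_comm]

/-! ### The Lebesgue integrals `∫_{[-π,π]^d} F_d`: the one-step bound and finiteness -/

/-- Off a null set all cosines of the coordinates are `< 1` (`cos x = 1` only on `2πℤ`).
[folklore] -/
theorem ae_forall_cos_apply_lt_one (n : ℕ) :
    ∀ᵐ p ∂(volume : Measure (Fin n → ℝ)), ∀ i, Real.cos (p i) < 1 := by
  rw [eventually_all]
  intro i
  have hnull : (volume : Measure (Fin n → ℝ))
      (Function.eval i ⁻¹' {x : ℝ | Real.cos x = 1}) = 0 := by
    rw [volume_pi]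
    refine Measure.pi_eval_preimage_null (μ := fun _ : Fin n => (volume : Measure ℝ)) (i := i) ?_
    have hsub : {x : ℝ | Real.cos x = 1} ⊆ Set.range (fun m : ℤ => (m : ℝ) * (2 * Real.pi)) :=
      fun x hx => (Real.cos_eq_one_iff x).1 hx
    exact measure_mono_null hsub ((Set.countable_range _).measure_zero volume)
  filter_upwards [measure_eq_zero_iff_ae_notMem.1 hnull] with p hp
  exact lt_of_le_of_ne (Real.cos_le_one _) hp

/-- **The one-step bound** `∫_{[-π,π]^{d+1}} F_{d+1} ≤ 2π ∫_{[-π,π]^d} F_d` (`d ≥ 1`), from the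
leave-one-out Jensen inequality (a.e.) and Tonelli at each deleted coordinate.
[Kennedy–Lieb–Shastry 1988, after eq. (8)] [cite: KLS1988PRL, after eq. (8)] -/
theorem lintegral_klsIntegrand_succ_le {d : ℕ} (hd : 1 ≤ d) :
    ∫⁻ p in Set.pi univ (fun _ : Fin (d + 1) => Icc (-Real.pi) Real.pi),
        ENNReal.ofReal (klsIntegrand (d + 1) p) ≤
      ENNReal.ofReal (2 * Real.pi) *
        ∫⁻ q in Set.pi univ (fun _ : Fin d => Icc (-Real.pi) Real.pi),
          ENNReal.ofReal (klsIntegrand d q) := by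
  have hd1 : (0 : ℝ) < ((d + 1 : ℕ) : ℝ) := by positivity
  have hmeas : ∀ k : Fin (d + 1), Measurable fun p : Fin (d + 1) → ℝ =>
      ENNReal.ofReal (klsIntegrand d (fun j => p (k.succAbove j))) := fun k =>
    ENNReal.measurable_ofReal.comp ((measurable_klsIntegrand d).comp
      (measurable_pi_lambda _ fun j => measurable_pi_apply _))
  have hae := ae_restrict_of_ae (s := Set.pi univ (fun _ : Fin (d + 1) => Icc (-Real.pi) Real.pi))
    (ae_forall_cos_apply_lt_one (d + 1))
  calc ∫⁻ p in Set.pi univ (fun _ : Fin (d + 1) => Icc (-Real.pi) Real.pi),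
        ENNReal.ofReal (klsIntegrand (d + 1) p)
      ≤ ∫⁻ p in Set.pi univ (fun _ : Fin (d + 1) => Icc (-Real.pi) Real.pi),
          ENNReal.ofReal ((∑ k : Fin (d + 1), klsIntegrand d (fun j => p (k.succAbove j))) /
            ((d + 1 : ℕ) : ℝ)) :=
        lintegral_mono_ae (hae.mono fun p hp =>
          ENNReal.ofReal_le_ofReal (klsIntegrand_succ_le_avg hd p hp))
    _ = ∫⁻ p in Set.pi univ (fun _ : Fin (d + 1) => Icc (-Real.pi) Real.pi),
          (∑ k : Fin (d + 1), ENNReal.ofReal (klsIntegrand d (fun j => p (k.succAbove j)))) *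
            ENNReal.ofReal (1 / ((d + 1 : ℕ) : ℝ)) := by
        refine lintegral_congr fun p => ?_
        rw [div_eq_mul_one_div, ENNReal.ofReal_mul (Finset.sum_nonneg fun k _ =>
          klsIntegrand_nonneg _ _), ENNReal.ofReal_sum_of_nonneg fun k _ => klsIntegrand_nonneg _ _]
    _ = (∑ k : Fin (d + 1), ∫⁻ p in Set.pi univ (fun _ : Fin (d + 1) => Icc (-Real.pi) Real.pi),
          ENNReal.ofReal (klsIntegrand d (fun j => p (k.succAbove j)))) *
            ENNReal.ofReal (1 / ((d + 1 : ℕ) : ℝ)) := by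
        rw [lintegral_mul_const _ (Finset.measurable_sum _ fun k _ => hmeas k),
          lintegral_finsetSum _ fun k _ => hmeas k]
    _ = (∑ _k : Fin (d + 1), ENNReal.ofReal (2 * Real.pi) *
          ∫⁻ q in Set.pi univ (fun _ : Fin d => Icc (-Real.pi) Real.pi),
            ENNReal.ofReal (klsIntegrand d q)) * ENNReal.ofReal (1 / ((d + 1 : ℕ) : ℝ)) := by
        congr 1
        exact Finset.sum_congr rfl fun k _ => setLIntegral_box_comp_succAbove k
          (ENNReal.measurable_ofReal.comp (measurable_klsIntegrand d))
    _ = ENNReal.ofReal (2 * Real.pi) *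
          ∫⁻ q in Set.pi univ (fun _ : Fin d => Icc (-Real.pi) Real.pi),
            ENNReal.ofReal (klsIntegrand d q) := by
        rw [Finset.sum_const, Finset.card_univ, Fintype.card_fin, nsmul_eq_mul, one_div,
          ENNReal.ofReal_inv_of_pos hd1, ENNReal.ofReal_natCast, mul_comm ((d + 1 : ℕ) : ℝ≥0∞),
          mul_assoc, ENNReal.mul_inv_cancel (by exact_mod_cast Nat.succ_ne_zero d)
            (ENNReal.natCast_ne_top _), mul_one]

/-- **Finiteness**: `∫_{[-π,π]^d} F_d < ∞` for every `d ≥ 2` (from `∫_{[-π,π]²} F₂ ≤ 6√2π` and the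
one-step bound, by induction). [Kennedy–Lieb–Shastry 1988, "the right-hand side of (5) is
integrable"] [folklore] -/
theorem lintegral_klsIntegrand_lt_top {d : ℕ} (hd : 2 ≤ d) :
    ∫⁻ p in Set.pi univ (fun _ : Fin d => Icc (-Real.pi) Real.pi),
        ENNReal.ofReal (klsIntegrand d p) < ∞ := by
  induction d, hd using Nat.le_induction with
  | base => exact lintegral_klsIntegrand_two_le.trans_lt ENNReal.ofReal_lt_top
  | succ d hd ih =>
      exact (lintegral_klsIntegrand_succ_le (by omega)).trans_lt
        (ENNReal.mul_lt_top ENNReal.ofReal_lt_top ih)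

/-- `I(d)` as a Lebesgue integral: `I(d) = (2π)^{-d} · toReal ∫⁻_{[-π,π]^d} F_d` (the integrand is
nonnegative and measurable). [folklore] -/
theorem klsIntegral_eq_toReal_lintegral (d : ℕ) :
    klsIntegral d =
      (∫⁻ p in Set.pi univ (fun _ : Fin d => Icc (-Real.pi) Real.pi),
          ENNReal.ofReal (klsIntegrand d p)).toReal / (2 * Real.pi) ^ d := by
  rw [klsIntegral, integral_eq_lintegral_of_nonneg_ae (Eventually.of_forall (klsIntegrand_nonneg d))
    (measurable_klsIntegrand d).aestronglyMeasurable]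

/-! ### `I(d+1) ≤ I(d)` and the discharge of (M) -/

/-- **Monotonicity in the dimension, one step**: `I(d+1) ≤ I(d)` for `d ≥ 2`.
[Kennedy–Lieb–Shastry 1988, after eq. (8): "by the same analysis one can also prove that
`I(ν) ≤ I(μ)` whenever `ν > μ`"] [cite: KLS1988PRL, after eq. (8)] -/
theorem klsIntegral_succ_le {d : ℕ} (hd : 2 ≤ d) : klsIntegral (d + 1) ≤ klsIntegral d := by
  rw [klsIntegral_eq_toReal_lintegral, klsIntegral_eq_toReal_lintegral]
  have hfin := lintegral_klsIntegrand_lt_top hd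
  have hstep := lintegral_klsIntegrand_succ_le (d := d) (by omega)
  have h2π : (0 : ℝ) < 2 * Real.pi := by positivity
  have hmono := ENNReal.toReal_mono (ENNReal.mul_ne_top ENNReal.ofReal_ne_top hfin.ne) hstep
  rw [ENNReal.toReal_ofReal_mul _ _ h2π.le] at hmono
  refine (div_le_div_of_nonneg_right hmono (by positivity)).trans (le_of_eq ?_)
  rw [pow_succ]
  field_simp

/-- **`I` is nonincreasing in the dimension**: `I(ν) ≤ I(μ)` for `2 ≤ μ ≤ ν`.
[Kennedy–Lieb–Shastry 1988, after eq. (8)] [cite: KLS1988PRL, after eq. (8)] -/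
theorem klsIntegral_antitone {μ ν : ℕ} (hμ : 2 ≤ μ) (hμν : μ ≤ ν) : klsIntegral ν ≤ klsIntegral μ := by
  induction ν, hμν using Nat.le_induction with
  | base => exact le_rfl
  | succ ν hν ih => exact (klsIntegral_succ_le (hμ.trans hν)).trans ih

/-- **Discharge of (M)** `klsIntegral_le_two`: `I(ν) ≤ I(2)` for every `ν ≥ 2`.
[Kennedy–Lieb–Shastry 1988, after eq. (8): "We shall now prove that `I(ν) ≤ I(2)` for `ν ≥ 3`"]
[cite: KLS1988PRL, after eq. (8)] -/
theorem klsIntegral_le_two_holds : klsIntegral_le_two := fun _ν hν =>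
  klsIntegral_antitone le_rfl hν

end DimensionMonotone

end Literature.MathematicalPhysics.QuantumLattice
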